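import Mathlib
import HarnessLib
import Summits.NavierStokesRegularity.NavierStokesRegularity.Theorems.TypeIQuarterGateScarEnvelopeTypeIForcedTsaiTypeIDefs
import Summits.NavierStokesRegularity.NavierStokesRegularity.Theorems.TypeIQuarterGateScarEnvelopeTypeIForcedTsaiAlgSoundX

/-!
# ARM B lane E-exact, Type-I-tail class — the symbolic TYPE-I DECAY CERTIFICATE and soundness in the repaired currency
  `ForcedTsaiModulusTypeILE C₀ M δ` (ns-wall-extremal typed-currency audit 2026-08-29; `…ForcedTsaiTypeIDefs`)

KERNEL.  A witness `U = evalVec5 τ u` (`u = curl5 Ψ`, 5-monomials `c·y^a t^k v^h`) has Type-I decay as soon as every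
monomial of `u` satisfies `h ≥ |a| + 2k + 1` (`Mono5.decayOK`): since `v ≤ min(1, τ/ρ)`,
`(1+ρ)·|c y^a t^k v^h| ≤ |c|·τ^{|a|+2k}·(1+τ)`, hence `‖U(y)‖ ≤ |U₁|+|U₂|+|U₃| ≤ C₀/(1+ρ)` with the (crude but exact) rational
`C₀ = decayC = (1+τ)·Σᵢ Σ_{mono ∈ uᵢ} |c| τ^{|a|+2k}` (`AlgRow.decayCheck C₀`: admissibility + `decayC ≤ C₀`).
SOUNDNESS.  `AlgRow.norm_field_le : decayCheck C₀ = true → ‖U y‖ ≤ C₀/(1+‖y‖)`; the level/residual halves of the landed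
soundness theorems restated for the EXPLICIT witness field (`AlgRowG.field_spec`, `AlgRowX.field_spec`); and
`AlgRowG.typeI_sound` / `AlgRowX.typeI_sound : check = true → decayCheck C₀ = true → ForcedTsaiModulusTypeILE C₀ M δ`.
A row of the repaired Prop is an UPPER bound / existence statement in the Type-I decay class; excludes nothing; nothing
about NS regularity; 23843 / H3 OPEN.
-/

noncomputable section

set_option linter.dupNamespace false

namespace Summit.NavierStokesRegularity.NavierStokesRegularity.Cruxes.ScarEnvelopeTypeI.ForcedTsai

open MeasureTheory Set Metric Real Finset
open scoped RealInnerProductSpace ContDiff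
open Literature.Analysis.FluidPDE

/-! ## Kernel: the decay certificate -/

namespace Mono5

/-- Type-I decay admissibility of a monomial of the velocity field: `h ≥ |a| + 2k + 1`. -/
def decayOK (m : Mono5) : Bool := decide (m.e1 + m.e2 + m.e3 + 2 * m.et + 1 ≤ m.eh)

/-- The decay weight `|c|·τ^{|a|+2k}` of a monomial. -/
def decayQ (τ : ℚ) (m : Mono5) : ℚ := |m.c| * τ ^ (m.e1 + m.e2 + m.e3 + 2 * m.et)

end Mono5

/-- All monomials admissible. -/
def Poly5.decayOK (P : Poly5) : Bool := P.all Mono5.decayOK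

/-- Sum of the decay weights. -/
def Poly5.decayQ (τ : ℚ) (P : Poly5) : ℚ := (P.map (Mono5.decayQ τ)).sum

namespace AlgRow

/-- The certified Type-I decay constant of the witness `U = curl Ψ`: `(1+τ)·Σᵢ decayQ(uᵢ)`. -/
def decayC (r : AlgRow) : ℚ :=
  (1 + r.tau) * (Poly5.decayQ r.tau (r.u 0) + Poly5.decayQ r.tau (r.u 1) + Poly5.decayQ r.tau (r.u 2))

/-- **The decay check** against a claimed constant `C₀`: `τ > 0`, every monomial of `u` admissible, `decayC ≤ C₀`. -/
def decayCheck (r : AlgRow) (C0 : ℚ) : Bool :=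
  decide (0 < r.tau) && (r.u 0).decayOK && (r.u 1).decayOK && (r.u 2).decayOK && decide (r.decayC ≤ C0)

end AlgRow

/-! ## The monomial decay inequality -/

/-- **Key inequality**: for `h ≥ n+1`, `(1+ρ)·ρⁿ·(1+ρ²/τ²)^{−h/2} ≤ (1+τ)·τⁿ` (`ρ = ‖y‖`, `τ > 0`). -/
theorem decay_key (τ : ℝ) (hτ : 0 < τ) (n h : ℕ) (hnh : n + 1 ≤ h) (y : E3) :
    (1 + ‖y‖) * (‖y‖ ^ n * vpow τ h y) ≤ (1 + τ) * τ ^ n := by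
  set ρ : ℝ := ‖y‖ with hρdef
  have hρ : 0 ≤ ρ := norm_nonneg y
  have hk1 : 1 ≤ kbase τ y := one_le_kbase τ y
  have hkpos : 0 < kbase τ y := kbase_pos τ y
  -- v^h ≤ v^{n+1}
  have hmono : vpow τ h y ≤ vpow τ (n + 1) y := by
    unfold vpow
    refine Real.rpow_le_rpow_of_exponent_le hk1 ?_
    have : ((n + 1 : ℕ) : ℝ) ≤ (h : ℝ) := by exact_mod_cast hnh
    push_cast at this ⊢; linarith
  have hv0 : 0 ≤ vpow τ h y := (vpow_pos τ h y).le
  have hv1 : vpow τ (n + 1) y ≤ 1 := vpow_le_one τ _ y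
  rcases le_or_gt ρ τ with hle | hgt
  · -- ρ ≤ τ
    calc (1 + ρ) * (ρ ^ n * vpow τ h y) ≤ (1 + ρ) * (ρ ^ n * 1) := by
          gcongr
          exact (hmono.trans hv1)
      _ ≤ (1 + τ) * (τ ^ n * 1) := by gcongr
      _ = (1 + τ) * τ ^ n := by ring
  · -- ρ > τ: v^{n+1} ≤ (τ/ρ)^{n+1}
    have hρpos : 0 < ρ := hτ.trans hgt
    have hbase : ρ ^ 2 / τ ^ 2 ≤ kbase τ y := by unfold kbase; rw [← hρdef]; linarith
    have hb0 : 0 < ρ ^ 2 / τ ^ 2 := by positivity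
    have hvn : vpow τ (n + 1) y ≤ (τ / ρ) ^ (n + 1) := by
      unfold vpow
      have hexp : (-(((n + 1 : ℕ) : ℝ)) / 2) ≤ 0 := by
        have : (0 : ℝ) ≤ ((n + 1 : ℕ) : ℝ) := Nat.cast_nonneg _
        linarith
      calc kbase τ y ^ (-(((n + 1 : ℕ) : ℝ)) / 2) ≤ (ρ ^ 2 / τ ^ 2) ^ (-(((n + 1 : ℕ) : ℝ)) / 2) :=
            Real.rpow_le_rpow_of_nonpos hb0 hbase hexp
        _ = (τ / ρ) ^ (n + 1) := by
            rw [show ρ ^ 2 / τ ^ 2 = (ρ / τ) ^ 2 by rw [div_pow], ← Real.rpow_natCast (ρ / τ) 2,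
              ← Real.rpow_mul (by positivity), show ((2 : ℕ) : ℝ) * (-(((n + 1 : ℕ) : ℝ)) / 2) = -(((n + 1 : ℕ) : ℝ)) by
                push_cast; ring, Real.rpow_neg (by positivity), Real.rpow_natCast, ← inv_pow, inv_div]
    have hρn : 0 ≤ ρ ^ n := pow_nonneg hρ n
    calc (1 + ρ) * (ρ ^ n * vpow τ h y) ≤ (1 + ρ) * (ρ ^ n * (τ / ρ) ^ (n + 1)) := by
          gcongr
          exact hmono.trans hvn
      _ = τ ^ n * (τ / ρ + τ) := by
          rw [div_pow, pow_succ τ]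
          field_simp
          ring
      _ ≤ τ ^ n * (1 + τ) := by
          gcongr
          rw [div_le_one hρpos]; exact hgt.le
      _ = (1 + τ) * τ ^ n := by ring

/-- **Monomial decay**: an admissible monomial satisfies `(1+‖y‖)·|c y^a t^k v^h| ≤ (1+τ)·decayQ`. -/
theorem Mono5.decay_eval {τq : ℚ} (hτq : 0 < τq) (m : Mono5) (hm : m.decayOK = true) (y : E3) :
    (1 + ‖y‖) * |Mono5.eval (τq : ℝ) m y| ≤ (1 + (τq : ℝ)) * (m.decayQ τq : ℝ) := by
  have hτ : (0 : ℝ) < τq := by exact_mod_cast hτq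
  simp only [Mono5.decayOK, decide_eq_true_eq] at hm
  have h0 : |y 0| ≤ ‖y‖ := by simpa using PiLp.norm_apply_le y 0
  have h1 : |y 1| ≤ ‖y‖ := by simpa using PiLp.norm_apply_le y 1
  have h2 : |y 2| ≤ ‖y‖ := by simpa using PiLp.norm_apply_le y 2
  have hv : 0 < vpow (τq : ℝ) m.eh y := vpow_pos _ _ y
  have habs : |Mono5.eval (τq : ℝ) m y| ≤
      |(m.c : ℝ)| * (‖y‖ ^ (m.e1 + m.e2 + m.e3 + 2 * m.et) * vpow (τq : ℝ) m.eh y) := by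
    rw [Mono5.eval, abs_mul, abs_mul, abs_mul, abs_mul, abs_mul, abs_of_pos hv, abs_pow, abs_pow, abs_pow, abs_pow,
      abs_of_nonneg (sq_nonneg ‖y‖)]
    have : |y 0| ^ m.e1 * |y 1| ^ m.e2 * |y 2| ^ m.e3 * (‖y‖ ^ 2) ^ m.et ≤ ‖y‖ ^ (m.e1 + m.e2 + m.e3 + 2 * m.et) := by
      rw [pow_add, pow_add, pow_add, pow_mul]
      gcongr
    calc |(m.c : ℝ)| * |y 0| ^ m.e1 * |y 1| ^ m.e2 * |y 2| ^ m.e3 * (‖y‖ ^ 2) ^ m.et * vpow (τq : ℝ) m.eh y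
        = |(m.c : ℝ)| * ((|y 0| ^ m.e1 * |y 1| ^ m.e2 * |y 2| ^ m.e3 * (‖y‖ ^ 2) ^ m.et) * vpow (τq : ℝ) m.eh y) := by ring
      _ ≤ |(m.c : ℝ)| * (‖y‖ ^ (m.e1 + m.e2 + m.e3 + 2 * m.et) * vpow (τq : ℝ) m.eh y) := by gcongr
  have hkey := decay_key (τq : ℝ) hτ (m.e1 + m.e2 + m.e3 + 2 * m.et) m.eh hm y
  have hpos : 0 ≤ 1 + ‖y‖ := by positivity
  calc (1 + ‖y‖) * |Mono5.eval (τq : ℝ) m y|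
      ≤ (1 + ‖y‖) * (|(m.c : ℝ)| * (‖y‖ ^ (m.e1 + m.e2 + m.e3 + 2 * m.et) * vpow (τq : ℝ) m.eh y)) :=
        mul_le_mul_of_nonneg_left habs hpos
    _ = |(m.c : ℝ)| * ((1 + ‖y‖) * (‖y‖ ^ (m.e1 + m.e2 + m.e3 + 2 * m.et) * vpow (τq : ℝ) m.eh y)) := by ring
    _ ≤ |(m.c : ℝ)| * ((1 + (τq : ℝ)) * (τq : ℝ) ^ (m.e1 + m.e2 + m.e3 + 2 * m.et)) :=
        mul_le_mul_of_nonneg_left hkey (abs_nonneg _)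
    _ = (1 + (τq : ℝ)) * (m.decayQ τq : ℝ) := by rw [Mono5.decayQ]; push_cast; ring

/-- **List decay**: `(1+‖y‖)·|Poly5.eval τ P y| ≤ (1+τ)·decayQ(P)` for an admissible list. -/
theorem Poly5.decay_eval {τq : ℚ} (hτq : 0 < τq) (P : Poly5) (hP : P.decayOK = true) (y : E3) :
    (1 + ‖y‖) * |Poly5.eval (τq : ℝ) P y| ≤ (1 + (τq : ℝ)) * (P.decayQ τq : ℝ) := by
  induction P with
  | nil => simp [Poly5.decayQ]
  | cons m P ih =>
    unfold Poly5.decayOK at hP ih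
    rw [List.all_cons, Bool.and_eq_true] at hP
    have hm := Mono5.decay_eval hτq m hP.1 y
    have hrest := ih hP.2
    rw [Poly5.eval_cons]
    rw [Poly5.decayQ, List.map_cons, List.sum_cons]
    have hpos : 0 ≤ 1 + ‖y‖ := by positivity
    have htri : |Mono5.eval (τq : ℝ) m y + Poly5.eval (τq : ℝ) P y| ≤
        |Mono5.eval (τq : ℝ) m y| + |Poly5.eval (τq : ℝ) P y| := abs_add_le _ _
    have := mul_le_mul_of_nonneg_left htri hpos
    rw [mul_add] at this
    rw [Poly5.decayQ] at hrest
    rw [Rat.cast_add, mul_add]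
    linarith [hm, hrest, this]

namespace AlgRow

/-- **Type-I decay of the witness field** from the decay check: `‖U(y)‖ ≤ C₀/(1+‖y‖)`. -/
theorem norm_field_le (r : AlgRow) (C0 : ℚ) (h : r.decayCheck C0 = true) (y : E3) :
    ‖r.field y‖ ≤ (C0 : ℝ) / (1 + ‖y‖) := by
  simp only [AlgRow.decayCheck, Bool.and_eq_true, decide_eq_true_eq] at h
  obtain ⟨⟨⟨⟨hτ, h0⟩, h1⟩, h2⟩, hC⟩ := h
  have hpos : 0 < 1 + ‖y‖ := by positivity
  rw [le_div_iff₀ hpos, mul_comm]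
  have e0 := Poly5.decay_eval hτ (r.u 0) h0 y
  have e1 := Poly5.decay_eval hτ (r.u 1) h1 y
  have e2 := Poly5.decay_eval hτ (r.u 2) h2 y
  have hn : ‖r.field y‖ ≤ |Poly5.eval r.tauR (r.u 0) y| + |Poly5.eval r.tauR (r.u 1) y| + |Poly5.eval r.tauR (r.u 2) y| := by
    -- `‖x‖ ≤ |x₀| + |x₁| + |x₂|` on `ℝ³` (inlined)
    have h3 : ∀ x : E3, ‖x‖ ≤ |x 0| + |x 1| + |x 2| := by
      intro x
      have hsq : ‖x‖ ^ 2 = x 0 ^ 2 + x 1 ^ 2 + x 2 ^ 2 := by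
        rw [EuclideanSpace.real_norm_sq_eq, Fin.sum_univ_three]
      have a0 := abs_nonneg (x 0)
      have a1 := abs_nonneg (x 1)
      have a2 := abs_nonneg (x 2)
      have habs : ‖x‖ ^ 2 ≤ (|x 0| + |x 1| + |x 2|) ^ 2 := by
        rw [hsq, ← sq_abs (x 0), ← sq_abs (x 1), ← sq_abs (x 2)]; nlinarith
      calc ‖x‖ = Real.sqrt (‖x‖ ^ 2) := (Real.sqrt_sq (norm_nonneg x)).symm
        _ ≤ Real.sqrt ((|x 0| + |x 1| + |x 2|) ^ 2) := Real.sqrt_le_sqrt habs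
        _ = |x 0| + |x 1| + |x 2| := Real.sqrt_sq (by positivity)
    have := h3 (r.field y)
    simpa [AlgRow.field, evalVec5_apply] using this
  have hτR : ((r.tau : ℚ) : ℝ) = r.tauR := rfl
  rw [hτR] at e0 e1 e2
  have hC' : ((1 + r.tau) * (Poly5.decayQ r.tau (r.u 0) + Poly5.decayQ r.tau (r.u 1) + Poly5.decayQ r.tau (r.u 2)) : ℝ) ≤ C0 := by
    have := hC; unfold AlgRow.decayC at this; exact_mod_cast this
  have hτcast : ((r.tau : ℚ) : ℝ) = r.tauR := rfl
  rw [hτcast, mul_add, mul_add] at hC'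
  calc (1 + ‖y‖) * ‖r.field y‖
      ≤ (1 + ‖y‖) * (|Poly5.eval r.tauR (r.u 0) y| + |Poly5.eval r.tauR (r.u 1) y| + |Poly5.eval r.tauR (r.u 2) y|) :=
        mul_le_mul_of_nonneg_left hn hpos.le
    _ = (1 + ‖y‖) * |Poly5.eval r.tauR (r.u 0) y| + (1 + ‖y‖) * |Poly5.eval r.tauR (r.u 1) y| +
          (1 + ‖y‖) * |Poly5.eval r.tauR (r.u 2) y| := by ring
    _ ≤ (1 + r.tauR) * (Poly5.decayQ r.tau (r.u 0) : ℝ) + (1 + r.tauR) * (Poly5.decayQ r.tau (r.u 1) : ℝ) +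
          (1 + r.tauR) * (Poly5.decayQ r.tau (r.u 2) : ℝ) := add_le_add (add_le_add e0 e1) e2
    _ ≤ (C0 : ℝ) := by linarith

end AlgRow

/-! ## Soundness in the repaired currency -/

namespace AlgRowG

/-- The v3 check certifies the level and residual of the EXPLICIT witness field. -/
theorem field_spec (r : AlgRowG) (h : r.checkG = true) :
    (r.M : ℝ) ≤ lerayLevel r.toRow.field ∧
      Integrable (fun y : E3 => (1 + ‖y‖) ^ 5 * ‖lerayVorticityResidual r.toRow.field y‖ ^ 2) ∧
        lerayResidualNorm r.toRow.field ≤ (r.δ : ℝ) := by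
  unfold AlgRowG.checkG at h
  rcases hL : r.toRowF.lev2F with _ | L <;> rcases hE : r.res2E with _ | R <;> rcases hO : r.res2O with _ | o <;>
    simp only [hL, hE, hO, Bool.and_false, Bool.and_eq_true, decide_eq_true_eq, Bool.false_eq_true] at h
  obtain ⟨⟨⟨⟨hτ, hM⟩, hδ⟩, hfloor⟩, hlev, hres⟩ := h
  have hτR : 0 < r.toRow.tauR := by unfold AlgRow.tauR AlgRowG.toRow; exact_mod_cast hτ
  have hτ0 : r.toRow.tauR ≠ 0 := hτR.ne'
  have hM' : (0 : ℝ) ≤ r.M := by exact_mod_cast hM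
  have hδ' : (0 : ℝ) ≤ r.δ := by exact_mod_cast hδ
  have hτq : 0 < r.toRow.tau := hτ
  obtain ⟨hintL, hIL⟩ := integral_poly5 hτq r.toRowF.levPolyF (c := L) hL
  obtain ⟨hintE, hIE⟩ := integral_poly5 hτq r.resPolyE (c := R) hE
  obtain ⟨hintO, hIO⟩ := integral_poly5_odd hτq r.resPolyO (c := o) hO
  have hτcast : ((r.toRow.tau : ℚ) : ℝ) = r.toRow.tauR := rfl
  rw [hτcast] at hintL hIL hintE hIE hintO hIO
  have hsum : Integrable (fun y : E3 => (1 + ‖y‖) ^ 5 * ‖lerayVorticityResidual r.toRow.field y‖ ^ 2) := by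
    refine (hintE.add hintO).congr (Filter.Eventually.of_forall fun y => ?_)
    rw [Pi.add_apply]
    beta_reduce
    rw [r.weight_mul_residual_eq hτ0 y]
  have hval : ∫ y, (1 + ‖y‖) ^ 5 * ‖lerayVorticityResidual r.toRow.field y‖ ^ 2 =
      ((R.1 + o : ℚ) : ℝ) * π + (R.2 : ℝ) * π ^ 2 := by
    have : (fun y : E3 => (1 + ‖y‖) ^ 5 * ‖lerayVorticityResidual r.toRow.field y‖ ^ 2) =
        fun y => Poly5.eval r.toRow.tauR r.resPolyE y + ‖y‖ * Poly5.eval r.toRow.tauR r.resPolyO y :=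
      funext fun y => r.weight_mul_residual_eq hτ0 y
    rw [this, integral_add hintE hintO, hIE, hIO]
    push_cast; ring
  refine ⟨?_, hsum, ?_⟩
  · unfold lerayLevel
    refine (Real.le_sqrt hM' (integral_nonneg fun y => sq_nonneg _)).mpr ?_
    have hind : IntegrableOn (fun y => ‖curl r.toRow.field y‖ ^ 2) (ball (0 : E3) 10) := by
      have hc : Continuous fun y => ‖curl r.toRow.field y‖ ^ 2 := by
        have : (fun y => ‖curl r.toRow.field y‖ ^ 2) = fun y => ‖evalVec5 r.toRow.tauR r.toRow.om y‖ ^ 2 :=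
          funext fun y => by rw [r.toRow.curl_field y]
        rw [this]; exact (continuous_evalVec5 _ _).norm.pow 2
      exact (hc.continuousOn.integrableOn_compact (isCompact_closedBall (0 : E3) 10)).mono_set ball_subset_closedBall
    have hmono : ∫ y, Poly5.eval r.toRow.tauR r.toRowF.levPolyF y ≤ ∫ y in ball (0 : E3) 10, ‖curl r.toRow.field y‖ ^ 2 := by
      rw [← MeasureTheory.integral_indicator measurableSet_ball]
      refine integral_mono hintL (hind.integrable_indicator measurableSet_ball) fun y => ?_
      beta_reduce
      rw [show r.toRow.tauR = r.toRowF.toRow.tauR from rfl, r.toRowF.eval_levPolyF y, toRowF_toRow]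
      have key := FloorCert.floor_mul_le hτ r.floor hfloor y (sq_nonneg ‖curl r.toRow.field y‖)
      refine key.trans (le_of_eq ?_)
      by_cases hy : y ∈ ball (0 : E3) 10
      · rw [indicator_of_mem hy, indicator_of_mem hy, one_mul]
      · rw [indicator_of_notMem hy, indicator_of_notMem hy, zero_mul]
    have hlev' : (r.M : ℝ) ^ 2 ≤ (encLo L : ℝ) := by
      have := hlev; rw [← sq] at this; exact_mod_cast this
    calc (r.M : ℝ) ^ 2 ≤ (encLo L : ℝ) := hlev'
      _ ≤ (L.1 : ℝ) * π + (L.2 : ℝ) * π ^ 2 := encLo_le L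
      _ = ∫ y, Poly5.eval r.toRow.tauR r.toRowF.levPolyF y := hIL.symm
      _ ≤ ∫ y in ball (0 : E3) 10, ‖curl r.toRow.field y‖ ^ 2 := hmono
  · unfold lerayResidualNorm
    rw [show (r.δ : ℝ) = Real.sqrt ((r.δ : ℝ) ^ 2) by rw [Real.sqrt_sq hδ']]
    refine Real.sqrt_le_sqrt ?_
    have hres' : (encHi (R.1 + o, R.2) : ℝ) ≤ (r.δ : ℝ) ^ 2 := by
      have := hres; rw [← sq] at this; exact_mod_cast this
    calc ∫ y, (1 + ‖y‖) ^ 5 * ‖lerayVorticityResidual r.toRow.field y‖ ^ 2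
        = ((R.1 + o : ℚ) : ℝ) * π + (R.2 : ℝ) * π ^ 2 := hval
      _ ≤ (encHi (R.1 + o, R.2) : ℝ) := le_encHi (R.1 + o, R.2)
      _ ≤ (r.δ : ℝ) ^ 2 := hres'

/-- **v3 soundness in the repaired currency**: `checkG` and the decay certificate give `ForcedTsaiModulusTypeILE C₀ M δ`. -/
theorem typeI_sound (r : AlgRowG) (C0 : ℚ) (h : r.checkG = true) (hd : r.toRow.decayCheck C0 = true) :
    ForcedTsaiModulusTypeILE (C0 : ℝ) (r.M : ℝ) (r.δ : ℝ) := by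
  obtain ⟨hlev, hint, hres⟩ := r.field_spec h
  exact ⟨r.toRow.field, r.toRow.contDiff_field, r.toRow.isDivFree_field, r.toRow.norm_field_le C0 hd, hlev, hint, hres⟩

end AlgRowG

namespace AlgRowX

/-- The v4 check certifies the exact level and residual of the EXPLICIT witness field. -/
theorem field_spec (r : AlgRowX) (h : r.checkX = true) :
    (r.M : ℝ) ≤ lerayLevel r.toRowG.toRow.field ∧
      Integrable (fun y : E3 => (1 + ‖y‖) ^ 5 * ‖lerayVorticityResidual r.toRowG.toRow.field y‖ ^ 2) ∧
        lerayResidualNorm r.toRowG.toRow.field ≤ (r.δ : ℝ) := by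
  unfold AlgRowX.checkX at h
  rcases hE : r.toRowG.res2E with _ | R <;> rcases hO : r.toRowG.res2O with _ | o <;>
    simp only [hE, hO, Bool.and_false, Bool.and_eq_true, decide_eq_true_eq, Bool.false_eq_true] at h
  obtain ⟨⟨⟨⟨hτ3, hM⟩, hδ⟩, hlev⟩, hres⟩ := h
  have hτq : 0 < r.tau := by rw [hτ3]; norm_num
  have hτq' : 0 < r.toRowG.toRow.tau := hτq
  have hτR : 0 < r.toRowG.toRow.tauR := by unfold AlgRow.tauR AlgRowG.toRow AlgRowX.toRowG; exact_mod_cast hτq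
  have hτ0 : r.toRowG.toRow.tauR ≠ 0 := hτR.ne'
  have hM' : (0 : ℝ) ≤ r.M := by exact_mod_cast hM
  have hδ' : (0 : ℝ) ≤ r.δ := by exact_mod_cast hδ
  obtain ⟨hintE, hIE⟩ := integral_poly5 hτq' r.toRowG.resPolyE (c := R) hE
  obtain ⟨hintO, hIO⟩ := integral_poly5_odd hτq' r.toRowG.resPolyO (c := o) hO
  obtain ⟨hintB, hIB⟩ := integral_ball_poly5 hτq r.om2Poly
  have hτcast : ((r.toRowG.toRow.tau : ℚ) : ℝ) = r.toRowG.toRow.tauR := rfl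
  have hτcast' : ((r.tau : ℚ) : ℝ) = r.toRowG.toRow.tauR := rfl
  rw [hτcast] at hintE hIE hintO hIO
  rw [hτcast'] at hintB hIB
  have hsum : Integrable (fun y : E3 => (1 + ‖y‖) ^ 5 * ‖lerayVorticityResidual r.toRowG.toRow.field y‖ ^ 2) := by
    refine (hintE.add hintO).congr (Filter.Eventually.of_forall fun y => ?_)
    rw [Pi.add_apply]
    beta_reduce
    rw [r.toRowG.weight_mul_residual_eq hτ0 y]
  have hval : ∫ y, (1 + ‖y‖) ^ 5 * ‖lerayVorticityResidual r.toRowG.toRow.field y‖ ^ 2 =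
      ((R.1 + o : ℚ) : ℝ) * π + (R.2 : ℝ) * π ^ 2 := by
    have : (fun y : E3 => (1 + ‖y‖) ^ 5 * ‖lerayVorticityResidual r.toRowG.toRow.field y‖ ^ 2) =
        fun y => Poly5.eval r.toRowG.toRow.tauR r.toRowG.resPolyE y +
          ‖y‖ * Poly5.eval r.toRowG.toRow.tauR r.toRowG.resPolyO y :=
      funext fun y => r.toRowG.weight_mul_residual_eq hτ0 y
    rw [this, integral_add hintE hintO, hIE, hIO]
    push_cast; ring
  refine ⟨?_, hsum, ?_⟩
  · unfold lerayLevel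
    refine (Real.le_sqrt hM' (integral_nonneg fun y => sq_nonneg _)).mpr ?_
    have hball : ∫ y in ball (0 : E3) 10, ‖curl r.toRowG.toRow.field y‖ ^ 2 =
        ∫ y in ball (0 : E3) 10, Poly5.eval r.toRowG.toRow.tauR r.om2Poly y :=
      setIntegral_congr_fun measurableSet_ball fun y _ => (r.eval_om2Poly y).symm
    have henc := Q4.encLoPi_le r.lev2X
    have hx : ((10 / r.tau : ℚ) : ℝ) = (((10 / (3 : ℚ) : ℚ) : ℝ)) := by rw [hτ3]
    have hlev' : (r.M : ℝ) ^ 2 ≤ (r.lev2X.encLoPi : ℝ) := by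
      have := hlev; rw [← sq] at this; exact_mod_cast this
    calc (r.M : ℝ) ^ 2 ≤ (r.lev2X.encLoPi : ℝ) := hlev'
      _ ≤ π * Q4.eval (((10 / (3 : ℚ) : ℚ) : ℝ)) r.lev2X := henc
      _ = π * Q4.eval ((10 / r.tau : ℚ) : ℝ) (Poly5.integrateBall r.tau r.om2Poly) := by rw [hx]; rfl
      _ = ∫ y in ball (0 : E3) 10, Poly5.eval r.toRowG.toRow.tauR r.om2Poly y := hIB.symm
      _ = ∫ y in ball (0 : E3) 10, ‖curl r.toRowG.toRow.field y‖ ^ 2 := hball.symm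
  · unfold lerayResidualNorm
    rw [show (r.δ : ℝ) = Real.sqrt ((r.δ : ℝ) ^ 2) by rw [Real.sqrt_sq hδ']]
    refine Real.sqrt_le_sqrt ?_
    have hres' : (encHi (R.1 + o, R.2) : ℝ) ≤ (r.δ : ℝ) ^ 2 := by
      have := hres; rw [← sq] at this; exact_mod_cast this
    calc ∫ y, (1 + ‖y‖) ^ 5 * ‖lerayVorticityResidual r.toRowG.toRow.field y‖ ^ 2
        = ((R.1 + o : ℚ) : ℝ) * π + (R.2 : ℝ) * π ^ 2 := hval
      _ ≤ (encHi (R.1 + o, R.2) : ℝ) := le_encHi (R.1 + o, R.2)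
      _ ≤ (r.δ : ℝ) ^ 2 := hres'

/-- **v4 soundness in the repaired currency**: `checkX` and the decay certificate give `ForcedTsaiModulusTypeILE C₀ M δ`. -/
theorem typeI_sound (r : AlgRowX) (C0 : ℚ) (h : r.checkX = true) (hd : r.toRowG.toRow.decayCheck C0 = true) :
    ForcedTsaiModulusTypeILE (C0 : ℝ) (r.M : ℝ) (r.δ : ℝ) := by
  obtain ⟨hlev, hint, hres⟩ := r.field_spec h
  exact ⟨r.toRowG.toRow.field, r.toRowG.toRow.contDiff_field, r.toRowG.toRow.isDivFree_field,
    r.toRowG.toRow.norm_field_le C0 hd, hlev, hint, hres⟩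

end AlgRowX

end Summit.NavierStokesRegularity.NavierStokesRegularity.Cruxes.ScarEnvelopeTypeI.ForcedTsai

end
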